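import Summits.HodgeConjecture.CorCM.Model.PoincareClass
import Summits.HodgeConjecture.CorCM.Model.KunnethOneOne
import Summits.HodgeConjecture.CorCM.Model.RosatiTensorForm
import HarnessLib

/-!
# COR-CM model layer, row M22 `Fact_algDuality`: the polar family IS the alternating dual pairing
# (`Σ_a φ(b_a) ψ(y_a) = B_ω(φ, ψ)`), and the Rosati tensor identity for the polar family

Cell `pub-hodgecm2` (COR-CM), seat `model-1` (kernel K-a).  This is the bridge between the two descriptions of a
degree-two class `θ ∈ H²(A(ℂ); ℚ)` of an abelian variety that the M22 chain uses:

* the **polar family** `y` of `θ` along a basis `b` of `H¹(A(ℂ); ℚ)` (kernel K-b, `CorCM/Model/PoincareClass`):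
  `m^*θ − pr₁^*θ − pr₂^*θ = Σ_a pr₁^* b_a ∪ pr₂^* y_a` on `A × A` (Mumford §20, the Riemann form read off the
  Poincaré class), unique by `polarFamily_unique` (`CorCM/Model/KunnethOneOne`);
* the **alternating dual pairing** `B_ω(φ, ψ) = exteriorPower.alternatingMapToDual ℚ _ 2 ![φ, ψ] ω` of the
  exterior square `ω ∈ ⋀² H¹` with `wedgeToCup ω = θ` (input R2 in Betti dual form, `CorCM/Model/RosatiDualForm`,
  `CorCM/Model/RosatiThetaProd4`).

`sum_dual_polarFamily_eq_altDual`: `Σ_a φ(b_a) · ψ(y_a) = B_ω(φ, ψ)` for all covectors `φ, ψ` — on a pure wedge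
`ω = x ∧ x'` both sides are `φ(x)ψ(x') − φ(x')ψ(x)` (`polClass_cup_one_one_eq_sum`, `altDual_two_ιMulti`), both
are additive in `ω` with the polar family additive, pure wedges span `⋀²` (`exteriorPower.ιMulti_span`), and the
polar family of `θ` is unique.  Consequently (`sum_tmul_polarFamily_rosati`, via b26's
`sum_tmul_rosati_of_altDual`) the dual-form Rosati identity `B_ω(φ ∘ T, ψ) = B_ω(φ, ψ ∘ T')` yields the TENSOR form
`Σ_a T(b_a) ⊗ y_a = Σ_a b_a ⊗ T'(y_a)` consumed by clause (ii) of `Fact_algDuality` (`CorCM/Model/AlgDuality`,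
hypothesis `hRos`/`hadj`).  Pure linear algebra over the tree's rational Betti carriers; no Hodge theory.
-/

noncomputable section

open CategoryTheory MonoidalCategory CartesianMonoidalCategory
open Literature.AlgebraicTopology.SingularHomology
open Literature.AlgebraicGeometry.Motives (SchemeOver ComplexPoints IsSmoothProjective bettiCohomology AbelianVariety)
open Literature.AlgebraicGeometry.HodgeTheory
open scoped MonObj TensorProduct

namespace Summit.HodgeConjecture.CorCM.Model

section PolarAltDual

variable (A : AbelianVariety ℂ)

/-- `wedgeToCup (x₀ ∧ x₁) = x₀ ∪ x₁` in `H²(A(ℂ); ℚ)`. [folklore] -/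
theorem wedgeToCup_ιMulti_two (v : Fin 2 → bettiCohomology A.X 1) :
    wedgeToCup ℚ (ComplexPoints A.X) 2 (exteriorPower.ιMulti ℚ 2 v) = BettiUniverse.cup A.X 1 1 (v 0) (v 1) := by
  rw [wedgeToCup_ιMulti, cupPowOne_succ, cupPowOne_one]
  rfl

/-- Expansion of a covector along a basis: `Σ_a (b.repr v)_a · φ(b_a) = φ(v)`. [folklore] -/
theorem sum_repr_mul_dual_basis {n : ℕ} (b : Module.Basis (Fin n) ℚ (bettiCohomology A.X 1))
    (φ : Module.Dual ℚ (bettiCohomology A.X 1)) (v : bettiCohomology A.X 1) :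
    ∑ a, b.repr v a * φ (b a) = φ v := by
  conv_rhs => rw [← b.sum_repr v]
  rw [map_sum]
  exact Finset.sum_congr rfl fun a _ ↦ by rw [map_smul, smul_eq_mul]

/-- **The polar family is the alternating dual pairing.**  For a basis `b` of `H¹(A(ℂ); ℚ)`, an exterior square
`ω ∈ ⋀² H¹(A(ℂ); ℚ)` and the polar family `y` of `θ = wedgeToCup ω` along `b`
(`m^*θ − pr₁^*θ − pr₂^*θ = Σ_a pr₁^* b_a ∪ pr₂^* y_a`), every pair of covectors `φ, ψ` satisfies
`Σ_a φ(b_a) · ψ(y_a) = B_ω(φ, ψ) := exteriorPower.alternatingMapToDual ℚ _ 2 ![φ, ψ] ω`.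
[cite: MumfordAV1970, §20 Thm. 1 and §1 (4)] [cite: LangeBirkenhake1992, Lemma 1.1.17] -/
theorem sum_dual_polarFamily_eq_altDual {n : ℕ} (b : Module.Basis (Fin n) ℚ (bettiCohomology A.X 1))
    (ω : ⋀[ℚ]^2 (bettiCohomology A.X 1)) {y : Fin n → bettiCohomology A.X 1}
    (hℓ : BettiUniverse.pull μ[A.X] 2 (wedgeToCup ℚ (ComplexPoints A.X) 2 ω) -
        BettiUniverse.pull (fst A.X A.X) 2 (wedgeToCup ℚ (ComplexPoints A.X) 2 ω) -
        BettiUniverse.pull (snd A.X A.X) 2 (wedgeToCup ℚ (ComplexPoints A.X) 2 ω) =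
      ∑ a, BettiUniverse.cup (A.X ⊗ A.X) 1 1 (BettiUniverse.pull (fst A.X A.X) 1 (b a))
        (BettiUniverse.pull (snd A.X A.X) 1 (y a)))
    (φ ψ : Module.Dual ℚ (bettiCohomology A.X 1)) :
    ∑ a, φ (b a) * ψ (y a) = exteriorPower.alternatingMapToDual ℚ (bettiCohomology A.X 1) 2 ![φ, ψ] ω := by
  -- the statement WITH its own polar family, for every `ω`, by span induction over pure wedges
  have key : ∀ ω' : ⋀[ℚ]^2 (bettiCohomology A.X 1), ∃ y' : Fin n → bettiCohomology A.X 1,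
      (BettiUniverse.pull μ[A.X] 2 (wedgeToCup ℚ (ComplexPoints A.X) 2 ω') -
          BettiUniverse.pull (fst A.X A.X) 2 (wedgeToCup ℚ (ComplexPoints A.X) 2 ω') -
          BettiUniverse.pull (snd A.X A.X) 2 (wedgeToCup ℚ (ComplexPoints A.X) 2 ω') =
        ∑ a, BettiUniverse.cup (A.X ⊗ A.X) 1 1 (BettiUniverse.pull (fst A.X A.X) 1 (b a))
          (BettiUniverse.pull (snd A.X A.X) 1 (y' a))) ∧
      ∀ φ ψ : Module.Dual ℚ (bettiCohomology A.X 1),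
        ∑ a, φ (b a) * ψ (y' a) = exteriorPower.alternatingMapToDual ℚ (bettiCohomology A.X 1) 2 ![φ, ψ] ω' := by
    intro ω'
    have hmem : ω' ∈ Submodule.span ℚ (Set.range (exteriorPower.ιMulti ℚ 2 (M := bettiCohomology A.X 1))) := by
      rw [exteriorPower.ιMulti_span]; exact Submodule.mem_top
    induction hmem using Submodule.span_induction with
    | mem x hx =>
      obtain ⟨v, rfl⟩ := hx
      refine ⟨fun a ↦ b.repr (v 0) a • v 1 - b.repr (v 1) a • v 0, ?_, fun φ ψ ↦ ?_⟩
      · rw [wedgeToCup_ιMulti_two]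
        exact polClass_cup_one_one_eq_sum A b (v 0) (v 1)
      · rw [altDual_two_ιMulti]
        have h1 : ∀ a, φ (b a) * ψ (b.repr (v 0) a • v 1 - b.repr (v 1) a • v 0) =
            (b.repr (v 0) a * φ (b a)) * ψ (v 1) - (b.repr (v 1) a * φ (b a)) * ψ (v 0) := fun a ↦ by
          rw [map_sub, map_smul, map_smul, smul_eq_mul, smul_eq_mul]; ring
        rw [Finset.sum_congr rfl fun a _ ↦ h1 a, Finset.sum_sub_distrib, ← Finset.sum_mul, ← Finset.sum_mul,
          sum_repr_mul_dual_basis A b φ (v 0), sum_repr_mul_dual_basis A b φ (v 1)]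
        ring
    | zero =>
      refine ⟨0, ?_, fun φ ψ ↦ ?_⟩
      · simp only [map_zero, sub_self, Pi.zero_apply, Finset.sum_const_zero]
      · simp only [Pi.zero_apply, map_zero, mul_zero, Finset.sum_const_zero]
    | add x x' _ _ hx hx' =>
      obtain ⟨y₁, h₁, p₁⟩ := hx
      obtain ⟨y₂, h₂, p₂⟩ := hx'
      refine ⟨y₁ + y₂, ?_, fun φ ψ ↦ ?_⟩
      · simp only [map_add, Pi.add_apply, Finset.sum_add_distrib, ← h₁, ← h₂]
        abel
      · simp only [Pi.add_apply, map_add, mul_add, Finset.sum_add_distrib, p₁, p₂]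
    | smul r x _ hx =>
      obtain ⟨y₁, h₁, p₁⟩ := hx
      refine ⟨r • y₁, ?_, fun φ ψ ↦ ?_⟩
      · simp only [map_smul, Pi.smul_apply, ← Finset.smul_sum, ← h₁, smul_sub]
      · simp only [Pi.smul_apply, map_smul, smul_eq_mul]
        rw [← p₁, Finset.mul_sum]
        exact Finset.sum_congr rfl fun a _ ↦ by ring
  obtain ⟨y', hℓ', hP⟩ := key ω
  have hyy : y = y' := polarFamily_unique A b (hℓ.symm.trans hℓ')
  subst hyy
  exact hP φ ψ

/-- **Rosati tensor identity for the polar family.**  With `b`, `ω`, `θ = wedgeToCup ω`, `y` as above: if the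
alternating dual pairing of `ω` satisfies the DUAL-FORM Rosati identity `B_ω(φ ∘ T, ψ) = B_ω(φ, ψ ∘ T')` for a
pair of endomorphisms `T, T'` of `H¹(A(ℂ); ℚ)` (e.g. `T = Ma^*`, `T' = Mb^*` acting diagonally by `a`, `ā`: R2,
`rosatiTheta_prod4`), then `Σ_a T(b_a) ⊗ y_a = Σ_a b_a ⊗ T'(y_a)` in `H¹ ⊗ H¹` — the hypothesis `hRos`/`hadj` of
clause (ii) of `Fact_algDuality` (`CorCM/Model/AlgDuality`). [cite: Shimura1998, §6.2 Theorem 4 (3)]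
[cite: LangeBirkenhake1992, §5.1] -/
theorem sum_tmul_polarFamily_rosati {n : ℕ} (b : Module.Basis (Fin n) ℚ (bettiCohomology A.X 1))
    (ω : ⋀[ℚ]^2 (bettiCohomology A.X 1)) {y : Fin n → bettiCohomology A.X 1}
    (hℓ : BettiUniverse.pull μ[A.X] 2 (wedgeToCup ℚ (ComplexPoints A.X) 2 ω) -
        BettiUniverse.pull (fst A.X A.X) 2 (wedgeToCup ℚ (ComplexPoints A.X) 2 ω) -
        BettiUniverse.pull (snd A.X A.X) 2 (wedgeToCup ℚ (ComplexPoints A.X) 2 ω) =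
      ∑ a, BettiUniverse.cup (A.X ⊗ A.X) 1 1 (BettiUniverse.pull (fst A.X A.X) 1 (b a))
        (BettiUniverse.pull (snd A.X A.X) 1 (y a)))
    (T T' : bettiCohomology A.X 1 →ₗ[ℚ] bettiCohomology A.X 1)
    (hros : ∀ φ ψ : Module.Dual ℚ (bettiCohomology A.X 1),
      exteriorPower.alternatingMapToDual ℚ (bettiCohomology A.X 1) 2 ![φ ∘ₗ T, ψ] ω =
        exteriorPower.alternatingMapToDual ℚ (bettiCohomology A.X 1) 2 ![φ, ψ ∘ₗ T'] ω) :
    ∑ a, T (b a) ⊗ₜ[ℚ] y a = ∑ a, b a ⊗ₜ[ℚ] T' (y a) :=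
  sum_tmul_rosati_of_altDual ω b y (fun φ ψ ↦ sum_dual_polarFamily_eq_altDual A b ω hℓ φ ψ) T T' hros

/-- The same with `θ ∈ H²(A(ℂ); ℚ)` and the exterior square recovered from the exterior-algebra structure
`H² = ⋀² H¹` (`hasExteriorCohomologyH1_rat`): if the dual-form Rosati identity holds for EVERY `ω` with
`wedgeToCup ω = θ` (the output shape of `rosatiTheta_prod4`), the polar family of `θ` along `b` satisfies the tensor
identity. [cite: Shimura1998, §6.2 Theorem 4 (3)] -/
theorem sum_tmul_polarFamily_rosati_of_forall {n : ℕ} (b : Module.Basis (Fin n) ℚ (bettiCohomology A.X 1))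
    {θ : bettiCohomology A.X 2} {y : Fin n → bettiCohomology A.X 1}
    (hℓ : BettiUniverse.pull μ[A.X] 2 θ - BettiUniverse.pull (fst A.X A.X) 2 θ - BettiUniverse.pull (snd A.X A.X) 2 θ =
      ∑ a, BettiUniverse.cup (A.X ⊗ A.X) 1 1 (BettiUniverse.pull (fst A.X A.X) 1 (b a))
        (BettiUniverse.pull (snd A.X A.X) 1 (y a)))
    (T T' : bettiCohomology A.X 1 →ₗ[ℚ] bettiCohomology A.X 1)
    (hros : ∀ ω : ⋀[ℚ]^2 (bettiCohomology A.X 1), wedgeToCup ℚ (ComplexPoints A.X) 2 ω = θ →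
      ∀ φ ψ : Module.Dual ℚ (bettiCohomology A.X 1),
        exteriorPower.alternatingMapToDual ℚ (bettiCohomology A.X 1) 2 ![φ ∘ₗ T, ψ] ω =
          exteriorPower.alternatingMapToDual ℚ (bettiCohomology A.X 1) 2 ![φ, ψ ∘ₗ T'] ω) :
    ∑ a, T (b a) ⊗ₜ[ℚ] y a = ∑ a, b a ⊗ₜ[ℚ] T' (y a) := by
  obtain ⟨ω, rfl⟩ : ∃ ω : ⋀[ℚ]^2 (bettiCohomology A.X 1), wedgeToCup ℚ (ComplexPoints A.X) 2 ω = θ :=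
    (hasExteriorCohomologyH1_rat A 2).2 θ
  exact sum_tmul_polarFamily_rosati A b ω hℓ T T' (hros ω rfl)

end PolarAltDual

end Summit.HodgeConjecture.CorCM.Model

end
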